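import Summits.ResolutionOfSingularities.ResolutionOfSingularities.Theorems.FrobeniusClosingPatchingRelPerfectDepthPhaseCLocalGamePersistence
import Summits.ResolutionOfSingularities.ResolutionOfSingularities.Theorems.FrobeniusClosingPatchingRelPerfectDepthPhaseCX3Defs
import HarnessLib

/-!
# Crux `PatchingRelPerfect` (stmt-ResolutionOfSingularities-16161), chain W5.2 — F7(β) (β-AX) X3 C-I (G2) engine:
# (G-P) `X3LemmaM.EndStratumStep` HOLDS (by-name wrapper over `X3LemmaM.endStratumStep`)

[OURS · L1 W5.2 · X3 definitions of record `…DepthPhaseCX3Defs` (res-L1-w52-lead-1, p569657) + (G-P) unfolded `…LocalGamePersistence`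
(res-D-pv-046, p568650/p569691)] Replaces the role of NO printed item; NOT a statement of the manuscript under review; fact-free.

* **`endStratumStep_holds : EndStratumStep`** — the literal (G-P) Prop of the X3 definitions of record, with `M := (C·𝒪)^m`,
  `K₁ := (π^*K : (C·𝒪)^m)` and `𝓛₁ := 𝓛.map st ++ [C·𝒪]`.

AI-written; AI review is weaker than expert review.
-/

-- `Summit.<Summit>.<Sub>.Theorems` with `Sub = Summit` (single-conjunct summit, D-0017)
set_option linter.dupNamespace false

noncomputable section

open CategoryTheory AlgebraicGeometry TopologicalSpace IsLocalRing
open Literature.AlgebraicGeometry.Resolution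

namespace Summit.ResolutionOfSingularities.ResolutionOfSingularities.Theorems

namespace X3LemmaM

universe u

/-- [OURS · L1 W5.2] **(G-P) PERSISTENCE STEP HOLDS**: `X3LemmaM.EndStratumStep` (X3 definitions of record), by `endStratumStep`.
[cite: Kollar2007, (3.111) Step 3] [cite: BierstoneGrigorievMilmanWlodarczyk2011, Def. 3.1.3, Lemma 3.2.1] [cite: GortzWedhorn2020, Prop. 13.91] -/
theorem endStratumStep_holds : EndStratumStep.{u} := by
  intro X _ hX K C 𝓛 m _ hEnd hCreg hCsing hCstr
  obtain ⟨hreg, hfac, hM, hend, hsupp⟩ := endStratumStep hX K C 𝓛 m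
    (fun x hx => by
      obtain ⟨Λ, hΛ, U, hxU, hsnc, 𝒦, hbd, hne, hK⟩ := hEnd x hx
      exact ⟨Λ, hΛ, U, hxU, hsnc, 𝒦, hbd, hne, hK⟩)
    hCreg hCsing
    (fun y hy => by
      obtain ⟨U, Λ, J, 𝒦, ⟨hyU, hΛ, hsnc, hbd, hne, hK⟩, hJ, hC⟩ := hCstr y hy
      exact ⟨U, Λ, J, 𝒦, ⟨hyU, hΛ, hsnc, hbd, hne, hK⟩, hJ, hC⟩)
  refine ⟨hreg, CentreSeq.isNoetherian_top (CentreSeq.single C), (C.comap (blowup.π C)) ^ m,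
    controlledTransform (blowup.π C) C K m, 𝓛.map (strictTransformIdeal (blowup.π C) C) ++ [C.comap (blowup.π C)],
    hfac, hM, rfl, fun x hx => ?_, hsupp⟩
  obtain ⟨Λ₁, hΛ₁, U₁, hxU₁, hsnc₁, 𝒦₁, hbd₁, hne₁, hK₁⟩ := hend x hx
  exact ⟨Λ₁, hΛ₁, U₁, hxU₁, hsnc₁, 𝒦₁, hbd₁, hne₁, hK₁⟩

end X3LemmaM

end Summit.ResolutionOfSingularities.ResolutionOfSingularities.Theorems

end
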